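import Summits.KontsevichZagierPeriods.KontsevichZagierPeriods.Theorems.LinRedNormalFormArrangementNormalFormStubRebaseSimplePosOnePosSepPred

/-!
# Stub `stub_rebaseSimplePosOnePos` (crux `ArrangementNormalForm`, line `janus-bands`) —
part `SepPredInv`: the separation engine with protected letters and an INVARIANT of the
silent factors

A generalisation of `SeparatePos.sep_induction` (part `SeparateEngine`): partial fractions in
the distinguished base coordinate `y` of a representation of separation shape
`P(x', y)/∏ Lⱼ(x')^{eⱼ} · ∏ⱼ (y − λⱼ(x'))^{−dⱼ} · (fibre block)`, in which only the letters of a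
chosen class `S` ("separable", a decidable predicate on the letter indices) are split from one
another: repeatedly `1/((y−λ)(y−μ)) = (λ−μ)⁻¹ (1/(y−λ) − 1/(y−μ))` (rule 1b) for pairs of DISTINCT
ACTIVE SEPARABLE letters, each piece being the parent times the bounded factor
`(y − μ)/(λ − μ)` (`SeparatePos.exists_piece`, domination = the ratio condition `hwall`, required
for separable pairs only); the protected letters, the numerator and the fibre block are carried
unchanged. The induction runs on the total multiplicity of the separable letters; the terminal
class `T` receives the shapes all of whose active separable letters coincide
(`SeparatePos.sep_induction_inv`, part `SepPred` plus an invariant: a predicate `PL` on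
`x'`-forms satisfied by all silent factors and by the resultants `λ_j − λ_{j'}` of separable
pairs (`hres`), handed to the terminal class — so that the terminal shapes can be read back as
LITERAL data of a prescribed kind). With `PL = ⊤` this is `sep_induction_pred`.

Use (line `janus-bands`, `B = 2` corner calculus of `stub_rebaseSimplePosOnePos`): separating
the FAR silent factors of a flat cell from one another in a generic direction (resultants are
units near the flat point, so the ratio condition holds after localisation), while the near
factors and the base pole — whose mutual resultants vanish at the flat point — stay protected.

References: M. Kontsevich, D. Zagier, *Periods* (2001), §1.2, rule (1b).
-/

noncomputable section

open Set MeasureTheory MvPolynomial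

namespace Summit.KontsevichZagierPeriods.ArrangementNormalForm.JanusBands

open Literature.NumberTheory.Transcendental

namespace SeparatePos

section InductionPred

variable {b k m m' r : ℕ}

/-- **Separation with protected letters and an invariant of the silent factors** (induction on
the total multiplicity of the separable letters `S`). See the module docstring. Hypotheses on the active separable letters
only: non-vanishing on the domain (`hpole`) and the ratio condition for distinct pairs
(`hwall`); conclusion: `[s]` is congruent modulo `KZ.relations` to the subgroup generated by any
class `T` containing the shapes whose active separable letters all coincide (`hT`). -/
theorem sep_induction_inv (b k m' r : ℕ) (M : Fin m' → (Fin (b + 1) → ℚ) × ℚ)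
    (p : MvPolynomial (Fin (b + 1)) ℚ) (lam : Fin r → (Fin b → ℚ) × ℚ)
    (a : Fin k → Option ((Fin (b + 1) → ℚ) × ℚ)) (lo hi : Fin k → Fin k ⊕ ((Fin (b + 1) → ℚ) × ℚ))
    (S : Fin r → Prop) [DecidablePred S] (PL : ((Fin b → ℚ) × ℚ) → Prop) (T : Set KZ.FormalRep)
    (hres : ∀ j j', S j → S j' → PL (lam j - lam j'))
    (hT : ∀ (m : ℕ) (L : Fin m → (Fin b → ℚ) × ℚ) (e : Fin m → ℕ) (d : Fin r → ℕ)
      (s : KZ.IntegralRep (b + 1 + k)), (∀ i, PL (L i)) → Bornology.IsBounded s.domain →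
      s.domain = gDom b k m' M lo hi → EqOn s.integrand (shape b k p L e lam d a) s.domain →
      (∀ j, S j → d j ≠ 0 → ∀ z ∈ s.domain, z (Fin.castAdd k (Fin.last b)) - affB b k (lam j) z ≠ 0) →
      (∀ j j', S j → S j' → d j ≠ 0 → d j' ≠ 0 → lam j = lam j') → KZ.of s ∈ T)
    (N : ℕ) :
    ∀ (m : ℕ) (L : Fin m → (Fin b → ℚ) × ℚ) (e : Fin m → ℕ) (d : Fin r → ℕ)
      (s : KZ.IntegralRep (b + 1 + k)), ∑ j ∈ Finset.univ.filter S, d j = N → (∀ i, PL (L i)) →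
      Bornology.IsBounded s.domain →
      s.domain = gDom b k m' M lo hi → EqOn s.integrand (shape b k p L e lam d a) s.domain →
      (∀ j, S j → d j ≠ 0 → ∀ z ∈ s.domain, z (Fin.castAdd k (Fin.last b)) - affB b k (lam j) z ≠ 0) →
      (∀ j j', S j → S j' → d j ≠ 0 → d j' ≠ 0 → lam j ≠ lam j' → ∃ C, ∀ z ∈ s.domain,
        |z (Fin.castAdd k (Fin.last b)) - affB b k (lam j') z| ≤
          C * |affB b k (lam j) z - affB b k (lam j') z|) →
      ∃ c ∈ AddSubgroup.closure T, KZ.of s - c ∈ KZ.relations := by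
  have hsnoc : ∀ {m : ℕ} (L : Fin m → (Fin b → ℚ) × ℚ) (x : (Fin b → ℚ) × ℚ), (∀ i, PL (L i)) → PL x →
      ∀ i, PL ((Fin.snoc L x : Fin (m + 1) → (Fin b → ℚ) × ℚ) i) := fun L x hL hx i => by
    refine Fin.lastCases ?_ (fun i => ?_) i
    · rwa [Fin.snoc_last]
    · rw [Fin.snoc_castSucc]; exact hL i
  induction N with
  | zero =>
    intro m L e d s hN hL hbd hdom hint hpole _
    have hd : ∀ j, S j → d j = 0 := fun j hj =>
      (Finset.sum_eq_zero_iff.mp hN) j (Finset.mem_filter.2 ⟨Finset.mem_univ _, hj⟩)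
    exact ⟨KZ.of s, AddSubgroup.subset_closure (hT m L e d s hL hbd hdom hint hpole
      fun j j' hj _ hdj _ => absurd (hd j hj) hdj), by simp⟩
  | succ N ih =>
    intro m L e d s hN hL hbd hdom hint hpole hwall
    by_cases hsplit : ∃ j j', S j ∧ S j' ∧ d j ≠ 0 ∧ d j' ≠ 0 ∧ lam j ≠ lam j'
    · obtain ⟨j, j', hSj, hSj', hj, hj', hne⟩ := hsplit
      obtain ⟨C₁, hC₁⟩ := hwall j j' hSj hSj' hj hj' hne
      obtain ⟨C₂, hC₂⟩ := hwall j' j hSj' hSj hj' hj hne.symm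
      obtain ⟨s₁, hd₁, hg₁, hi₁⟩ := exists_piece L e p lam d a s hint j j' hj' (hpole j' hSj' hj') hC₁
      obtain ⟨s₂, hd₂, hg₂, hi₂⟩ := exists_piece L e p lam d a s hint j' j hj (hpole j hSj hj) hC₂
      have hrel : KZ.of s - KZ.of s₁ - KZ.of s₂ ∈ KZ.relations := by
        refine KZ.integrandAddRel_subset_relations ⟨_, s, s₁, s₂, hd₁, hd₂, fun z hz => ?_, rfl⟩
        have hR : affB b k (lam j) z - affB b k (lam j') z ≠ 0 := fun h => hpole j' hSj' hj' z hz
          (abs_eq_zero.mp (le_antisymm (by simpa [h] using hC₁ z hz) (abs_nonneg _)))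
        have key : (z (Fin.castAdd k (Fin.last b)) - affB b k (lam j') z) /
              (affB b k (lam j) z - affB b k (lam j') z) +
            (z (Fin.castAdd k (Fin.last b)) - affB b k (lam j) z) /
              (affB b k (lam j') z - affB b k (lam j) z) = 1 := by
          rw [show affB b k (lam j') z - affB b k (lam j) z =
              -(affB b k (lam j) z - affB b k (lam j') z) by ring, div_neg, ← sub_eq_add_neg,
            ← sub_div, div_eq_one_iff_eq hR]
          ring
        rw [Pi.add_apply, hg₁, hg₂, ← mul_add, key, mul_one]
      obtain ⟨c₁, hc₁, hr₁⟩ := ih (m + 1) _ _ _ s₁ (sum_filter_update S d j' hSj' hj' hN)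
        (hsnoc L _ hL (hres j j' hSj hSj')) (by rw [hd₁]; exact hbd) (hd₁.trans hdom) hi₁
        (fun i hi hdi z hz => hpole i hi (ne_zero_of_update_ne_zero hdi) z (by rw [← hd₁]; exact hz))
        (fun i i' hi hi' hdi hdi' hii' => by
          obtain ⟨C', hb'⟩ := hwall i i' hi hi' (ne_zero_of_update_ne_zero hdi)
            (ne_zero_of_update_ne_zero hdi') hii'
          exact ⟨C', fun z hz => hb' z (by rw [← hd₁]; exact hz)⟩)
      obtain ⟨c₂, hc₂, hr₂⟩ := ih (m + 1) _ _ _ s₂ (sum_filter_update S d j hSj hj hN)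
        (hsnoc L _ hL (hres j' j hSj' hSj)) (by rw [hd₂]; exact hbd) (hd₂.trans hdom) hi₂
        (fun i hi hdi z hz => hpole i hi (ne_zero_of_update_ne_zero hdi) z (by rw [← hd₂]; exact hz))
        (fun i i' hi hi' hdi hdi' hii' => by
          obtain ⟨C', hb'⟩ := hwall i i' hi hi' (ne_zero_of_update_ne_zero hdi)
            (ne_zero_of_update_ne_zero hdi') hii'
          exact ⟨C', fun z hz => hb' z (by rw [← hd₂]; exact hz)⟩)
      refine ⟨c₁ + c₂, add_mem hc₁ hc₂, ?_⟩
      have : KZ.of s - (c₁ + c₂) =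
          (KZ.of s - KZ.of s₁ - KZ.of s₂) + (KZ.of s₁ - c₁) + (KZ.of s₂ - c₂) := by abel
      rw [this]
      exact add_mem (add_mem hrel hr₁) hr₂
    · push Not at hsplit
      exact ⟨KZ.of s, AddSubgroup.subset_closure (hT m L e d s hL hbd hdom hint hpole
        fun j j' hj hj' hdj hdj' => hsplit j j' hj hj' hdj hdj'), by simp⟩

/-- `sep_induction_inv` without the multiplicity counter. -/
theorem sep_of_inv (M : Fin m' → (Fin (b + 1) → ℚ) × ℚ)
    (p : MvPolynomial (Fin (b + 1)) ℚ) (lam : Fin r → (Fin b → ℚ) × ℚ)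
    (a : Fin k → Option ((Fin (b + 1) → ℚ) × ℚ)) (lo hi : Fin k → Fin k ⊕ ((Fin (b + 1) → ℚ) × ℚ))
    (S : Fin r → Prop) [DecidablePred S] (PL : ((Fin b → ℚ) × ℚ) → Prop) (T : Set KZ.FormalRep)
    (hres : ∀ j j', S j → S j' → PL (lam j - lam j'))
    (hT : ∀ (m : ℕ) (L : Fin m → (Fin b → ℚ) × ℚ) (e : Fin m → ℕ) (d : Fin r → ℕ)
      (s : KZ.IntegralRep (b + 1 + k)), (∀ i, PL (L i)) → Bornology.IsBounded s.domain →
      s.domain = gDom b k m' M lo hi → EqOn s.integrand (shape b k p L e lam d a) s.domain →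
      (∀ j, S j → d j ≠ 0 → ∀ z ∈ s.domain, z (Fin.castAdd k (Fin.last b)) - affB b k (lam j) z ≠ 0) →
      (∀ j j', S j → S j' → d j ≠ 0 → d j' ≠ 0 → lam j = lam j') → KZ.of s ∈ T)
    (L : Fin m → (Fin b → ℚ) × ℚ) (e : Fin m → ℕ) (d : Fin r → ℕ) (s : KZ.IntegralRep (b + 1 + k))
    (hL : ∀ i, PL (L i)) (hbd : Bornology.IsBounded s.domain) (hdom : s.domain = gDom b k m' M lo hi)
    (hint : EqOn s.integrand (shape b k p L e lam d a) s.domain)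
    (hpole : ∀ j, S j → d j ≠ 0 → ∀ z ∈ s.domain, z (Fin.castAdd k (Fin.last b)) - affB b k (lam j) z ≠ 0)
    (hwall : ∀ j j', S j → S j' → d j ≠ 0 → d j' ≠ 0 → lam j ≠ lam j' → ∃ C, ∀ z ∈ s.domain,
      |z (Fin.castAdd k (Fin.last b)) - affB b k (lam j') z| ≤ C * |affB b k (lam j) z - affB b k (lam j') z|) :
    ∃ c ∈ AddSubgroup.closure T, KZ.of s - c ∈ KZ.relations :=
  sep_induction_inv b k m' r M p lam a lo hi S PL T hres hT _ m L e d s rfl hL hbd hdom hint hpole hwall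

end InductionPred

end SeparatePos

/-- **Registered part of `stub_rebaseSimplePosOnePos` (line `janus-bands`): the separation
engine with protected letters and an invariant of the silent factors**
(`SeparatePos.sep_of_inv`, any `b`, `k`): as `rebaseSimplePos_sepOfPred`, with a predicate `PL`
satisfied by all silent factors and by the resultants of separable pairs, passed on to the
terminal class (all new silent factors are such resultants). -/
theorem rebaseSimplePos_sepOfInv (b k m m' r : ℕ) (M : Fin m' → (Fin (b + 1) → ℚ) × ℚ) (p : MvPolynomial (Fin (b + 1)) ℚ) (lam : Fin r → (Fin b → ℚ) × ℚ) (a : Fin k → Option ((Fin (b + 1) → ℚ) × ℚ)) (lo hi : Fin k → Fin k ⊕ ((Fin (b + 1) → ℚ) × ℚ)) (S : Fin r → Prop) [DecidablePred S] (PL : ((Fin b → ℚ) × ℚ) → Prop) (T : Set KZ.FormalRep) (hres : ∀ j j', S j → S j' → PL (lam j - lam j')) (hT : ∀ (m : ℕ) (L : Fin m → (Fin b → ℚ) × ℚ) (e : Fin m → ℕ) (d : Fin r → ℕ) (s : KZ.IntegralRep (b + 1 + k)), (∀ i, PL (L i)) → Bornology.IsBounded s.domain → s.domain = SeparatePos.gDom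 b k m' M lo hi → Set.EqOn s.integrand (SeparatePos.shape b k p L e lam d a) s.domain → (∀ j, S j → d j ≠ 0 → ∀ z ∈ s.domain, z (Fin.castAdd k (Fin.last b)) - SeparatePos.affB b k (lam j) z ≠ 0) → (∀ j j', S j → S j' → d j ≠ 0 → d j' ≠ 0 → lam j = lam j') → KZ.of s ∈ T) (L : Fin m → (Fin b → ℚ) × ℚ) (e : Fin m → ℕ) (d : Fin r → ℕ) (s : KZ.IntegralRep (b + 1 + k)) (hL : ∀ i, PL (L i)) (hbd : Bornology.IsBounded s.domain) (hdom : s.domain = SeparatePos.gDom b k m' M lo hi) (hint : Set.EqOn s.integrand (SeparatePos.shape b k p L e lam d a) s.domain) (hpole : ∀ j, S j → d j ≠ 0 → ∀ z ∈ s.domain, z (Fin.castAdd k (Fin.last b)) - SeparatePos.affB b k (lam j) z ≠ 0) (hwall : ∀ j j', S j → S j' → d j ≠ 0 → d j' ≠ 0 → lam j ≠ lam j' → ∃ C : ℝ, ∀ z ∈ s.domain, |z (Fin.castAdd k (Fin.last b)) - SeparatePos.affB b k (lam j') z| ≤ C * |SeparatePos.affB b k (lam j) z - SeparatePos.affB b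 k (lam j') z|) : ∃ c ∈ AddSubgroup.closure T, KZ.of s - c ∈ KZ.relations :=
  SeparatePos.sep_of_inv M p lam a lo hi S PL T hres hT L e d s hL hbd hdom hint hpole hwall

end Summit.KontsevichZagierPeriods.ArrangementNormalForm.JanusBands
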